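import Mathlib
import Literature.Probability.Percolation.SmoothedWhiteNoise
import Literature.Probability.Percolation.Crossings
import Literature.Probability.Percolation.PlanarDuality
import Literature.Probability.Percolation.KSTPeriodicDefs
import Literature.Probability.Percolation.KSTPeriodicStatements
import Literature.Probability.Percolation.KSTPeriodicDualMeasure
import Literature.Probability.Percolation.BondPercolationSymmetry
import Summits.CriticalPhenomena.CardyFormulaZ2.Theorems.CardyWhiteToColouredDriftBoundPlackettDefs
import Summits.CriticalPhenomena.CardyFormulaZ2.Theorems.CardyWhiteToColouredDriftBoundPlackettVar
import Summits.CriticalPhenomena.CardyFormulaZ2.Theorems.CardyWhiteToColouredDriftBoundStubSignLawInvariant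
import Summits.CriticalPhenomena.CardyFormulaZ2.Theorems.CardyWhiteToColouredDriftBoundStubSignLawSelfDual
import Summits.CriticalPhenomena.CardyFormulaZ2.Theorems.CardyWhiteToColouredDriftBoundStubRegLimit

/-!
# Plackett/Piterbarg drift of the noise heat flow: admissibility of the pair-regularised sign law

Helper file for crux item `DriftBound` (stmt-CriticalPhenomena-4596) of route `CardyWhiteToColoured`
(`CardyFormulaZ2`), skeleton v4.1 of line `registered` (lead c3), sub-goal `pl_pairLaw_admissible`.

The **pair-regularised, variance-normalised sign configuration** of the noise `ξ` (i.i.d. `N(0,1)`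
on the edges of `ℤ²`) with an independent regularising noise `ζ` (again i.i.d. `N(0,1)` on the
edges) at level `η` is
`cfg (ξ, ζ) = {e ∈ E(ℤ²) | X̃^σ_e(ξ) + η ζ_e > 0}`, `X̃^σ_e(ξ) = normNoise σ ξ (m e)` the
variance-normalised Gaussian-smoothed field read at the medial point `m e = medialPoint 1 e`.
Its law `M = cfg_* (latticeWhiteNoise ⊗ latticeWhiteNoise)` is the pair law behind the regularised
flow `regFlow I A η σ`. We prove that `M` is a lattice-carried probability measure invariant under
all translations of `ℤ²`, under the transposition `(x₀, x₁) ↦ (x₁, x₀)` and under planar duality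
(`dualConfig`) — exactly the hypotheses of `sw_real_lrRect_succ_self`, so that the `(n+1) × n` box
crossing `LR([0, n+1] × [0, n])` has `M`-probability exactly `1/2` at every width `σ > 0` (the
self-dual certificate for the vanishing of the Plackett drift of that event).

* Symmetries (`pa2_map_map_act`): a bijection `g` of `ℤ²` preserving adjacency and moving medial
  points isometrically induces a bijection `ĝ` of `E(ℤ²)`; both the smoothed field
  (`inv_smoothedNoise_comp`) and its variance `noiseVar σ` (`pa2_noiseVar_map`, the same
  reindexing of the series `∑ q_σ²`) are transported, so `X̃^σ(ξ ∘ ĝ⁻¹)(g e) = X̃^σ(ξ)(e)` and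
  `g • cfg (ξ, ζ) = cfg (ξ ∘ ĝ⁻¹, ζ ∘ ĝ⁻¹)` pointwise (`pa2_act_cfg`); relabelling both noises
  preserves the product Gaussian measure (`Measure.map_infinitePi_infinitePi_of_inj`,
  `MeasurePreserving.prod`).
* Duality (`pa2_map_map_dualConfig`): with `ψ f` the primal edge crossed by the dual edge `f`
  (`sd_exists_equiv`, `m (ψ f) = m f + (1/2, 1/2)`) and `Φ ξ = (f ↦ −ξ (ψ f))`, the normalised
  field satisfies `X̃^σ(Φ ξ)(x) = −X̃^σ(ξ)(x + (1/2,1/2))` (numerator `sd_smoothedNoise_neg_reindex`,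
  variance `pa2_noiseVar_add`), whence `dualConfig (cfg (ξ, ζ)) = cfg (Φ ξ, Φ ζ)` as soon as no
  value `X̃^σ_e(ξ) + η ζ_e` vanishes (`pa2_dualConfig_cfg`). Ties are null (`pa2_ae_noTie`): for
  `η = 0` by `sd_ae_smoothedNoise_ne_zero`, for `η ≠ 0` by Fubini, `ζ_e ~ N(0,1)` having no atom.
  `Φ × Φ` preserves the product measure (`sd_map_neg_reindex`).

References: G. Grimmett, *Percolation* (1999), §11.2 (planar duality on `ℤ²`), §1.6 (invariance of
product measures under relabelling); L. Köhler-Schindler, V. Tassion, Duke Math. J. 172 (2023), §1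
(symmetries); S. Muirhead, H. Vanneuville, Ann. Inst. H. Poincaré Probab. Stat. 56 (2020), §2.1.
-/

noncomputable section

namespace Summit.CriticalPhenomena.CardyFormulaZ2.Cruxes.DriftBound.Birth

open Set Filter MeasureTheory ProbabilityTheory
open Literature.Probability.LatticeModels Literature.Probability.Percolation
open Summit.CriticalPhenomena.CardyFormulaZ2.Theorems.WhiteToColoured

/-! ### Transport of the variance and of the normalised field -/

/-- Reindexing the variance series: if the bijection `τ` of `E(ℤ²)` matches the distances
`|x − m(τ e')| = |y − m e'|`, then `noiseVar σ x = noiseVar σ y` (the Gaussian kernel is radial;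
unconditional sums, `Equiv.tsum_eq`). -/
theorem pa2_noiseVar_eq_of_norm (σ : ℝ) (τ : (zdGraph 2).edgeSet ≃ (zdGraph 2).edgeSet) (x y : ℂ)
    (h : ∀ e' : (zdGraph 2).edgeSet, ‖x - medialPoint 1 (τ e').1‖ = ‖y - medialPoint 1 e'.1‖) :
    noiseVar σ x = noiseVar σ y := by
  unfold noiseVar
  calc ∑' e' : (zdGraph 2).edgeSet, gaussWeight σ (x - medialPoint 1 e'.1) ^ 2
      = ∑' e' : (zdGraph 2).edgeSet, gaussWeight σ (x - medialPoint 1 (τ e').1) ^ 2 :=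
        (Equiv.tsum_eq τ (fun e' : (zdGraph 2).edgeSet =>
          gaussWeight σ (x - medialPoint 1 e'.1) ^ 2)).symm
    _ = ∑' e' : (zdGraph 2).edgeSet, gaussWeight σ (y - medialPoint 1 e'.1) ^ 2 :=
        tsum_congr fun e' => by unfold gaussWeight; rw [h e']

/-- **Transport of the variance under a lattice symmetry.** If `g` moves medial points
isometrically and `τ` is the induced bijection of the edge set, then
`noiseVar σ (m (g e)) = noiseVar σ (m e)`. -/
theorem pa2_noiseVar_map (σ : ℝ) (g : Site 2 ≃ Site 2)
    (hiso : ∀ e e' : Sym2 (Site 2),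
      ‖medialPoint 1 (Sym2.map g e) - medialPoint 1 (Sym2.map g e')‖ =
        ‖medialPoint 1 e - medialPoint 1 e'‖)
    (τ : (zdGraph 2).edgeSet ≃ (zdGraph 2).edgeSet)
    (hτ : ∀ e : (zdGraph 2).edgeSet, ((τ e : (zdGraph 2).edgeSet) : Sym2 (Site 2)) = Sym2.map g e.1)
    (e : Sym2 (Site 2)) :
    noiseVar σ (medialPoint 1 (Sym2.map g e)) = noiseVar σ (medialPoint 1 e) :=
  pa2_noiseVar_eq_of_norm σ τ _ _ fun e' => by rw [hτ, hiso]

/-- **Transport of the normalised field under a lattice symmetry**: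
`X̃^σ(ξ ∘ τ⁻¹)(m (g e)) = X̃^σ(ξ)(m e)` (numerator by `inv_smoothedNoise_comp`, variance by
`pa2_noiseVar_map`). -/
theorem pa2_normNoise_comp (σ : ℝ) (g : Site 2 ≃ Site 2)
    (hiso : ∀ e e' : Sym2 (Site 2),
      ‖medialPoint 1 (Sym2.map g e) - medialPoint 1 (Sym2.map g e')‖ =
        ‖medialPoint 1 e - medialPoint 1 e'‖)
    (τ : (zdGraph 2).edgeSet ≃ (zdGraph 2).edgeSet)
    (hτ : ∀ e : (zdGraph 2).edgeSet, ((τ e : (zdGraph 2).edgeSet) : Sym2 (Site 2)) = Sym2.map g e.1)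
    (ξ : (zdGraph 2).edgeSet → ℝ) (e : Sym2 (Site 2)) :
    normNoise σ (ξ ∘ τ.symm) (medialPoint 1 (Sym2.map g e)) = normNoise σ ξ (medialPoint 1 e) := by
  unfold normNoise
  rw [inv_smoothedNoise_comp σ 1 g hiso τ hτ ξ e, pa2_noiseVar_map σ g hiso τ hτ e]

/-- **Transport of the variance under the duality shift**: if `m (ψ f) = m f + c` for a bijection
`ψ` of the edge set, then `noiseVar σ (x + c) = noiseVar σ x`. -/
theorem pa2_noiseVar_add (σ : ℝ) (ψ : (zdGraph 2).edgeSet ≃ (zdGraph 2).edgeSet) (c : ℂ)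
    (hψ : ∀ f : (zdGraph 2).edgeSet, medialPoint 1 (ψ f).1 = medialPoint 1 f.1 + c) (x : ℂ) :
    noiseVar σ (x + c) = noiseVar σ x :=
  pa2_noiseVar_eq_of_norm σ ψ _ _ fun f => by rw [hψ, add_sub_add_right_eq_sub]

/-- **The normalised field of the reindexed, negated noise**: if `m (ψ f) = m f + c`, then
`X̃^σ(f ↦ −ξ (ψ f))(x) = −X̃^σ(ξ)(x + c)`. -/
theorem pa2_normNoise_neg_reindex (σ : ℝ) (ψ : (zdGraph 2).edgeSet ≃ (zdGraph 2).edgeSet) (c : ℂ)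
    (hψ : ∀ f : (zdGraph 2).edgeSet, medialPoint 1 (ψ f).1 = medialPoint 1 f.1 + c)
    (ξ : (zdGraph 2).edgeSet → ℝ) (x : ℂ) :
    normNoise σ (fun f => -ξ (ψ f)) x = -normNoise σ ξ (x + c) := by
  unfold normNoise
  rw [sd_smoothedNoise_neg_reindex ψ c hψ σ ξ x, pa2_noiseVar_add σ ψ c hψ x, neg_div]

/-! ### The pair-regularised sign configuration -/

/-- The value `X̃^σ_e(ξ) + η ζ_e` read on a lattice edge `e` is a measurable function of the pair
of noises. -/
theorem pa2_measurable_val (σ η : ℝ) (e : (zdGraph 2).edgeSet) :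
    Measurable fun p : ((zdGraph 2).edgeSet → ℝ) × ((zdGraph 2).edgeSet → ℝ) =>
      normNoise σ p.1 (medialPoint 1 e.1) + η * p.2 e :=
  ((rl_measurable_normNoise σ _).comp measurable_fst).add
    (measurable_const.mul ((measurable_pi_apply e).comp measurable_snd))

/-- **Measurability of the pair-regularised sign configuration** `cfg : (ξ, ζ) ↦ {e | X̃_e + η ζ_e > 0}`
(edge by edge, `measurable_set_iff`). -/
theorem pa2_measurable_cfg (σ η : ℝ)
    (cfg : ((zdGraph 2).edgeSet → ℝ) × ((zdGraph 2).edgeSet → ℝ) → Set (Sym2 (Site 2)))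
    (hcfg : ∀ p e, e ∈ cfg p ↔
      ∃ h : e ∈ (zdGraph 2).edgeSet, 0 < normNoise σ p.1 (medialPoint 1 e) + η * p.2 ⟨e, h⟩) :
    Measurable cfg := by
  refine measurable_set_iff.2 fun e => ?_
  simp_rw [hcfg]
  by_cases he : e ∈ (zdGraph 2).edgeSet
  · simp_rw [exists_prop_of_true he]
    exact measurableSet_setOf.1 (measurableSet_lt measurable_const (pa2_measurable_val σ η ⟨e, he⟩))
  · have : (fun p : ((zdGraph 2).edgeSet → ℝ) × ((zdGraph 2).edgeSet → ℝ) =>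
        ∃ h : e ∈ (zdGraph 2).edgeSet, 0 < normNoise σ p.1 (medialPoint 1 e) + η * p.2 ⟨e, h⟩) =
        fun _ => False := funext fun p => propext ⟨fun ⟨h, _⟩ => he h, False.elim⟩
    rw [this]
    exact measurable_const

/-- The pair-regularised sign configuration only opens lattice edges. -/
theorem pa2_cfg_subset {σ η : ℝ}
    (cfg : ((zdGraph 2).edgeSet → ℝ) × ((zdGraph 2).edgeSet → ℝ) → Set (Sym2 (Site 2)))
    (hcfg : ∀ p e, e ∈ cfg p ↔
      ∃ h : e ∈ (zdGraph 2).edgeSet, 0 < normNoise σ p.1 (medialPoint 1 e) + η * p.2 ⟨e, h⟩)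
    (p : ((zdGraph 2).edgeSet → ℝ) × ((zdGraph 2).edgeSet → ℝ)) :
    cfg p ⊆ (zdGraph 2).edgeSet := fun e he => by
  obtain ⟨h, -⟩ := (hcfg p e).1 he
  exact h

/-- **The pair law is lattice-carried** (`cfg ⊆ E(ℤ²)` surely; the event is measurable,
countably many non-edges). -/
theorem pa2_latticeCarried {σ η : ℝ}
    (cfg : ((zdGraph 2).edgeSet → ℝ) × ((zdGraph 2).edgeSet → ℝ) → Set (Sym2 (Site 2)))
    (hcfg : ∀ p e, e ∈ cfg p ↔
      ∃ h : e ∈ (zdGraph 2).edgeSet, 0 < normNoise σ p.1 (medialPoint 1 e) + η * p.2 ⟨e, h⟩) :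
    KSTPeriodic.LatticeCarried ((latticeWhiteNoise.prod latticeWhiteNoise).map cfg) := by
  have hmeas : MeasurableSet {ω : BondConfig (Site 2) | ω ⊆ (zdGraph 2).edgeSet} := by
    have h : {ω : BondConfig (Site 2) | ω ⊆ (zdGraph 2).edgeSet} =
        ⋂ e ∈ ((zdGraph 2).edgeSet)ᶜ, {ω | e ∉ ω} := by
      ext ω
      simp only [Set.mem_setOf_eq, Set.mem_iInter, Set.mem_compl_iff]
      exact ⟨fun h e he heω => he (h heω), fun h e heω => by_contra fun he => h e he heω⟩
    rw [h]
    exact MeasurableSet.biInter (Set.to_countable _) fun e _ => (measurableSet_mem e).compl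
  exact (ae_map_iff (pa2_measurable_cfg σ η cfg hcfg).aemeasurable hmeas).2
    (Filter.Eventually.of_forall fun p => pa2_cfg_subset cfg hcfg p)

/-! ### Lattice symmetries -/

/-- **Equivariance of the pair-regularised sign configuration.** For a bijection `g` of `ℤ²`
preserving adjacency and moving medial points isometrically, with induced edge bijection `τ`:
`g • cfg (ξ, ζ) = cfg (ξ ∘ τ⁻¹, ζ ∘ τ⁻¹)`. -/
theorem pa2_act_cfg {σ η : ℝ}
    (cfg : ((zdGraph 2).edgeSet → ℝ) × ((zdGraph 2).edgeSet → ℝ) → Set (Sym2 (Site 2)))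
    (hcfg : ∀ p e, e ∈ cfg p ↔
      ∃ h : e ∈ (zdGraph 2).edgeSet, 0 < normNoise σ p.1 (medialPoint 1 e) + η * p.2 ⟨e, h⟩)
    (g : Site 2 ≃ Site 2) (hadj : ∀ x y, (zdGraph 2).Adj (g x) (g y) ↔ (zdGraph 2).Adj x y)
    (hiso : ∀ e e' : Sym2 (Site 2),
      ‖medialPoint 1 (Sym2.map g e) - medialPoint 1 (Sym2.map g e')‖ =
        ‖medialPoint 1 e - medialPoint 1 e'‖)
    (τ : (zdGraph 2).edgeSet ≃ (zdGraph 2).edgeSet)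
    (hτ : ∀ e : (zdGraph 2).edgeSet, ((τ e : (zdGraph 2).edgeSet) : Sym2 (Site 2)) = Sym2.map g e.1)
    (p : ((zdGraph 2).edgeSet → ℝ) × ((zdGraph 2).edgeSet → ℝ)) :
    KST2023.act g (cfg p) = cfg (p.1 ∘ τ.symm, p.2 ∘ τ.symm) := by
  ext z
  obtain ⟨z, rfl⟩ := (sym2Equiv g).surjective z
  rw [BondConfig.mem_relabel_iff, Equiv.symm_apply_apply, hcfg, hcfg, sym2Equiv_apply]
  by_cases hz : z ∈ (zdGraph 2).edgeSet
  · have hz' : Sym2.map g z ∈ (zdGraph 2).edgeSet := (KSTPeriodic.map_mem_edgeSet_iff hadj z).2 hz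
    have hτz : τ.symm ⟨Sym2.map g z, hz'⟩ = ⟨z, hz⟩ := by
      rw [Equiv.symm_apply_eq]
      exact Subtype.ext (hτ ⟨z, hz⟩).symm
    rw [exists_prop_of_true hz, exists_prop_of_true hz']
    simp only [Function.comp_apply, hτz]
    rw [pa2_normNoise_comp σ g hiso τ hτ p.1 z]
  · have hz' : Sym2.map g z ∉ (zdGraph 2).edgeSet :=
      fun h => hz ((KSTPeriodic.map_mem_edgeSet_iff hadj z).1 h)
    exact ⟨fun ⟨h, _⟩ => absurd h hz, fun ⟨h, _⟩ => absurd h hz'⟩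

/-- Relabelling the i.i.d. Gaussian noise by a bijection of the edge set preserves
`latticeWhiteNoise` (`Measure.map_infinitePi_infinitePi_of_inj`). -/
theorem pa2_measurePreserving_reindex (τ : (zdGraph 2).edgeSet ≃ (zdGraph 2).edgeSet) :
    MeasurePreserving (fun ξ : (zdGraph 2).edgeSet → ℝ => ξ ∘ τ.symm)
      latticeWhiteNoise latticeWhiteNoise :=
  ⟨measurable_pi_lambda _ fun i => measurable_pi_apply (τ.symm i),
    Measure.map_infinitePi_infinitePi_of_inj
      (P := fun _ : (zdGraph 2).edgeSet => gaussianReal 0 1) τ.symm.injective⟩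

/-- **Invariance of the pair law under an isometric lattice symmetry.** If `g` preserves
adjacency and moves medial points isometrically, then `g_* M = M` for the pair law
`M = cfg_* (latticeWhiteNoise ⊗ latticeWhiteNoise)`. -/
theorem pa2_map_map_act {σ η : ℝ}
    (cfg : ((zdGraph 2).edgeSet → ℝ) × ((zdGraph 2).edgeSet → ℝ) → Set (Sym2 (Site 2)))
    (hcfg : ∀ p e, e ∈ cfg p ↔
      ∃ h : e ∈ (zdGraph 2).edgeSet, 0 < normNoise σ p.1 (medialPoint 1 e) + η * p.2 ⟨e, h⟩)
    (g : Site 2 ≃ Site 2) (hadj : ∀ x y, (zdGraph 2).Adj (g x) (g y) ↔ (zdGraph 2).Adj x y)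
    (hiso : ∀ e e' : Sym2 (Site 2),
      ‖medialPoint 1 (Sym2.map g e) - medialPoint 1 (Sym2.map g e')‖ =
        ‖medialPoint 1 e - medialPoint 1 e'‖) :
    ((latticeWhiteNoise.prod latticeWhiteNoise).map cfg).map (KST2023.act g) =
      (latticeWhiteNoise.prod latticeWhiteNoise).map cfg := by
  obtain ⟨τ, hτ⟩ : ∃ τ : (zdGraph 2).edgeSet ≃ (zdGraph 2).edgeSet,
      ∀ e : (zdGraph 2).edgeSet, ((τ e : (zdGraph 2).edgeSet) : Sym2 (Site 2)) = Sym2.map g e.1 :=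
    ⟨(sym2Equiv g).subtypeEquiv fun z => (KSTPeriodic.map_mem_edgeSet_iff hadj z).symm,
      fun _ => rfl⟩
  have hmp := (pa2_measurePreserving_reindex τ).prod (pa2_measurePreserving_reindex τ)
  have hmeas := pa2_measurable_cfg σ η cfg hcfg
  have hcomp : (KST2023.act g) ∘ cfg = cfg ∘ Prod.map (fun ξ : (zdGraph 2).edgeSet → ℝ => ξ ∘ τ.symm)
      (fun ξ : (zdGraph 2).edgeSet → ℝ => ξ ∘ τ.symm) :=
    funext fun p => pa2_act_cfg cfg hcfg g hadj hiso τ hτ p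
  rw [Measure.map_map (KST2023.act g).measurable hmeas, hcomp, ← Measure.map_map hmeas hmp.measurable,
    hmp.map_eq]

/-! ### Planar duality -/

/-- **Pointwise duality without ties.** With `ψ f` the primal edge crossed by `f`, shifted by `c`
at the level of medial points, and no vanishing value `X̃^σ_e(ξ) + η ζ_e`, the dual of
`cfg (ξ, ζ)` is `cfg (f ↦ −ξ (ψ f), f ↦ −ζ (ψ f))`. -/
theorem pa2_dualConfig_cfg {σ η : ℝ}
    (cfg : ((zdGraph 2).edgeSet → ℝ) × ((zdGraph 2).edgeSet → ℝ) → Set (Sym2 (Site 2)))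
    (hcfg : ∀ p e, e ∈ cfg p ↔
      ∃ h : e ∈ (zdGraph 2).edgeSet, 0 < normNoise σ p.1 (medialPoint 1 e) + η * p.2 ⟨e, h⟩)
    (ψ : (zdGraph 2).edgeSet ≃ (zdGraph 2).edgeSet) (c : ℂ)
    (hψE : ∀ f : (zdGraph 2).edgeSet, dualEdge (ψ f).1 = f.1)
    (hψ : ∀ f : (zdGraph 2).edgeSet, medialPoint 1 (ψ f).1 = medialPoint 1 f.1 + c)
    (p : ((zdGraph 2).edgeSet → ℝ) × ((zdGraph 2).edgeSet → ℝ))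
    (hties : ∀ e : (zdGraph 2).edgeSet, normNoise σ p.1 (medialPoint 1 e.1) + η * p.2 e ≠ 0) :
    dualConfig (cfg p) = cfg (fun f => -p.1 (ψ f), fun f => -p.2 (ψ f)) := by
  ext f
  rw [dualConfig_eq, mem_setOf_eq, hcfg, hcfg]
  by_cases hf : f ∈ (zdGraph 2).edgeSet
  · have h1 : dualEdgeEquiv.symm f = (ψ ⟨f, hf⟩).1 := by
      apply dualEdgeEquiv.injective
      rw [Equiv.apply_symm_apply, dualEdgeEquiv_apply, hψE]
    have h2 : medialPoint 1 f + c = medialPoint 1 (ψ ⟨f, hf⟩).1 := (hψ ⟨f, hf⟩).symm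
    rw [h1, exists_prop_of_true hf, exists_prop_of_true (ψ ⟨f, hf⟩).2, Subtype.coe_eta,
      pa2_normNoise_neg_reindex σ ψ c hψ p.1, h2]
    have hne := hties (ψ ⟨f, hf⟩)
    simp only [hf, true_and, not_lt]
    constructor
    · intro h
      have h' := lt_of_le_of_ne h hne
      nlinarith
    · intro h
      nlinarith
  · exact ⟨fun ⟨h, _⟩ => absurd h hf, fun ⟨h, _⟩ => absurd h hf⟩

/-- **No ties, almost surely.** For `σ > 0` and every `η`, almost surely (for the pair of
independent white noises) no value `X̃^σ_e(ξ) + η ζ_e` vanishes: for `η = 0` this is the absence of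
atoms of the smoothed field (`sd_ae_smoothedNoise_ne_zero`); for `η ≠ 0`, conditionally on `ξ`
the tie forces `ζ_e` to take one value, a null event for the atomless `N(0,1)` (Fubini). -/
theorem pa2_ae_noTie {σ : ℝ} (hσ : 0 < σ) (η : ℝ) :
    ∀ᵐ p ∂(latticeWhiteNoise.prod latticeWhiteNoise),
      ∀ e : (zdGraph 2).edgeSet, normNoise σ p.1 (medialPoint 1 e.1) + η * p.2 e ≠ 0 := by
  rw [ae_all_iff]
  intro e
  rcases eq_or_ne η 0 with rfl | hη
  · have h1 : ∀ᵐ ξ ∂latticeWhiteNoise, normNoise σ ξ (medialPoint 1 e.1) ≠ 0 := by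
      filter_upwards [sd_ae_smoothedNoise_ne_zero hσ (medialPoint 1 e.1)] with ξ hξ
      exact (pl_normNoise_ne_zero_iff hσ ξ _).2 hξ
    have h2 := (measurePreserving_fst (μ := latticeWhiteNoise)
      (ν := latticeWhiteNoise)).quasiMeasurePreserving.ae h1
    filter_upwards [h2] with p hp
    simpa only [zero_mul, add_zero] using hp
  · have hmeas : MeasurableSet {p : ((zdGraph 2).edgeSet → ℝ) × ((zdGraph 2).edgeSet → ℝ) |
        normNoise σ p.1 (medialPoint 1 e.1) + η * p.2 e ≠ 0} :=
      (pa2_measurable_val σ η e (measurableSet_singleton 0)).compl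
    rw [Measure.ae_prod_iff_ae_ae hmeas]
    refine ae_of_all _ fun ξ => ?_
    haveI := nullSingletonClass_gaussianReal (μ := (0 : ℝ)) (v := 1) one_ne_zero
    have h3 : ∀ᵐ t ∂(gaussianReal 0 1), t ≠ -normNoise σ ξ (medialPoint 1 e.1) / η := by
      rw [ae_iff]
      simp only [not_not, setOf_eq_eq_singleton, measure_singleton]
    have h4 : ∀ᵐ ζ ∂latticeWhiteNoise,
        ζ e ≠ -normNoise σ ξ (medialPoint 1 e.1) / η :=
      (measurePreserving_eval_infinitePi (fun _ : (zdGraph 2).edgeSet => gaussianReal 0 1)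
        e).quasiMeasurePreserving.ae h3
    filter_upwards [h4] with ζ hζ
    intro h0
    apply hζ
    field_simp
    linarith

/-- Reindexing by a bijection of the edge set and negating the i.i.d. Gaussian noise preserves
`latticeWhiteNoise` (`sd_map_neg_reindex`). -/
theorem pa2_measurePreserving_negReindex (ψ : (zdGraph 2).edgeSet ≃ (zdGraph 2).edgeSet) :
    MeasurePreserving (fun (ξ : (zdGraph 2).edgeSet → ℝ) (f : (zdGraph 2).edgeSet) => -ξ (ψ f))
      latticeWhiteNoise latticeWhiteNoise :=
  ⟨measurable_pi_lambda _ fun f => (measurable_pi_apply (ψ f)).neg, sd_map_neg_reindex ψ⟩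

/-- **Exact self-duality of the pair law.** For `σ > 0`: `dualConfig_* M = M` for
`M = cfg_* (latticeWhiteNoise ⊗ latticeWhiteNoise)`: almost surely
`dualConfig ∘ cfg = cfg ∘ (Φ × Φ)` (`pa2_dualConfig_cfg`, `pa2_ae_noTie`), and `Φ × Φ` preserves
the product measure. -/
theorem pa2_map_map_dualConfig {σ η : ℝ} (hσ : 0 < σ)
    (cfg : ((zdGraph 2).edgeSet → ℝ) × ((zdGraph 2).edgeSet → ℝ) → Set (Sym2 (Site 2)))
    (hcfg : ∀ p e, e ∈ cfg p ↔
      ∃ h : e ∈ (zdGraph 2).edgeSet, 0 < normNoise σ p.1 (medialPoint 1 e) + η * p.2 ⟨e, h⟩) :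
    ((latticeWhiteNoise.prod latticeWhiteNoise).map cfg).map dualConfig =
      (latticeWhiteNoise.prod latticeWhiteNoise).map cfg := by
  obtain ⟨ψ, hψE, hψ⟩ := sd_exists_equiv
  have hmp := (pa2_measurePreserving_negReindex ψ).prod (pa2_measurePreserving_negReindex ψ)
  have hmeas := pa2_measurable_cfg σ η cfg hcfg
  have hae : (dualConfig ∘ cfg) =ᵐ[latticeWhiteNoise.prod latticeWhiteNoise]
      (cfg ∘ Prod.map
        (fun (ξ : (zdGraph 2).edgeSet → ℝ) (f : (zdGraph 2).edgeSet) => -ξ (ψ f))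
        (fun (ξ : (zdGraph 2).edgeSet → ℝ) (f : (zdGraph 2).edgeSet) => -ξ (ψ f))) := by
    filter_upwards [pa2_ae_noTie hσ η] with p hp
    exact pa2_dualConfig_cfg cfg hcfg ψ _ hψE hψ p hp
  rw [Measure.map_map measurable_dualConfig hmeas, Measure.map_congr hae,
    ← Measure.map_map hmeas hmp.measurable, hmp.map_eq]

/-! ### Assembly -/

/-- **Admissibility of the pair law**, for an abstract `cfg` with the defining membership. -/
theorem pa2_admissible {σ : ℝ} (hσ : 0 < σ) (η : ℝ)
    (cfg : ((zdGraph 2).edgeSet → ℝ) × ((zdGraph 2).edgeSet → ℝ) → Set (Sym2 (Site 2)))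
    (hcfg : ∀ p e, e ∈ cfg p ↔
      ∃ h : e ∈ (zdGraph 2).edgeSet, 0 < normNoise σ p.1 (medialPoint 1 e) + η * p.2 ⟨e, h⟩) :
    IsProbabilityMeasure ((latticeWhiteNoise.prod latticeWhiteNoise).map cfg) ∧
    KSTPeriodic.LatticeCarried ((latticeWhiteNoise.prod latticeWhiteNoise).map cfg) ∧
    (∀ v : Site 2, ((latticeWhiteNoise.prod latticeWhiteNoise).map cfg).map
        (KST2023.act (Site.shift v)) = (latticeWhiteNoise.prod latticeWhiteNoise).map cfg) ∧
    ((latticeWhiteNoise.prod latticeWhiteNoise).map cfg).map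
        (KST2023.act KSTPeriodic.transposeEquiv) =
      (latticeWhiteNoise.prod latticeWhiteNoise).map cfg ∧
    ((latticeWhiteNoise.prod latticeWhiteNoise).map cfg).map dualConfig =
      (latticeWhiteNoise.prod latticeWhiteNoise).map cfg :=
  ⟨Measure.isProbabilityMeasure_map (pa2_measurable_cfg σ η cfg hcfg).aemeasurable,
    pa2_latticeCarried cfg hcfg,
    fun v => pa2_map_map_act cfg hcfg (Site.shift v) (zdGraph_adj_shift_iff v)
      (inv_norm_medialPoint_map_shift 1 v),
    pa2_map_map_act cfg hcfg KSTPeriodic.transposeEquiv KSTPeriodic.transposeEquiv_adj_iff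
      (inv_norm_medialPoint_map_transpose 1),
    pa2_map_map_dualConfig hσ cfg hcfg⟩

/-- **Sub-goal `pl_pairLaw_admissible` — admissibility of the pair-regularised sign law.** For
`σ > 0` and every `η`, the law `M` of the configuration `{e ∈ E(ℤ²) | X̃^σ_e(ξ) + η ζ_e > 0}`
(`X̃^σ = normNoise σ`, the variance-normalised Gaussian-smoothed lattice white noise `ξ`; `ζ` an
independent lattice white noise) is a probability measure carried by lattice configurations,
invariant under all translations of `ℤ²`, under the transposition `(x₀, x₁) ↦ (x₁, x₀)` and under
planar duality `dualConfig` — the hypotheses of `sw_real_lrRect_succ_self`, whence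
`M(LR([0, n+1] × [0, n])) = 1/2` for every `n` and every width `σ`. -/
theorem pl_pairLaw_admissible : ∀ (σ η : ℝ), 0 < σ → ∀ M : MeasureTheory.Measure (Set (Sym2 (Literature.Probability.LatticeModels.Site 2))), M = MeasureTheory.Measure.map (fun p : ((Literature.Probability.LatticeModels.zdGraph 2).edgeSet → ℝ) × ((Literature.Probability.LatticeModels.zdGraph 2).edgeSet → ℝ) => {e : Sym2 (Literature.Probability.LatticeModels.Site 2) | ∃ h : e ∈ (Literature.Probability.LatticeModels.zdGraph 2).edgeSet, 0 < Summit.CriticalPhenomena.CardyFormulaZ2.Cruxes.DriftBound.Birth.normNoise σ p.1 (Literature.Probability.LatticeModels.medialPoint 1 e) + η * p.2 ⟨e, h⟩}) (Literature.Probability.Percolation.latticeWhiteNoise.prod Literature.Probability.Percolation.latticeWhiteNoise) → MeasureTheory.IsProbabilityMeasure M ∧ Literature.Probability.Percolation.KSTPeriodic.LatticeCarried M ∧ (∀ v : Literature.Probability.LatticeModels.Site 2, M.map (Literature.Probability.Percolation.KST2023.act (Literature.Probability.LatticeModels.Site.shift v)) = M) ∧ M.map (Literature.Probability.Percolation.KST2023.act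 Literature.Probability.Percolation.KSTPeriodic.transposeEquiv) = M ∧ M.map Literature.Probability.Percolation.dualConfig = M := by
  intro σ η hσ M hM
  subst hM
  exact pa2_admissible hσ η _ fun p e => Iff.rfl

end Summit.CriticalPhenomena.CardyFormulaZ2.Cruxes.DriftBound.Birth

end
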